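import Summits.NavierStokesRegularity.NavierStokesRegularity.Theorems.TypeIIInviscidRelaxationAxisymSwirlRegularWallFloorCriterion
import Summits.NavierStokesRegularity.NavierStokesRegularity.Theorems.TypeIIInviscidRelaxationAxisymSwirlRegularSplitTightness
import HarnessLib

/-!
# Crux `AxisymSwirlRegular` (stmt-NavierStokesRegularity-1964), line `radial_inflow_split`:
# the continuation criterion with the pressure floor localised to the inflow jet

`--supports stmt-NavierStokesRegularity-1964` (helper file; theorems only, no definitions).

Sharpening of `…WallFloorCriterion.lean`: in Lieberman's weak maximum principle the sub-solution
inequality is evaluated only at a point where the comparison function is positive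
(`weak_max_principle_of_contDiffAt_of_pos`, `Literature/Analysis/FluidPDE/ParabolicWeakMaxPointwise.lean`),
so the floor for the cyclostrophic defect is needed only at strongest-inflow points where the radial
momentum is already below the wall level, `r u_r < −L` — inside the inflow jet.

* `radialMomentum_minPrinciple_engine_jet`, `hasSmoothExtensionPast_of_wallInflow_of_jetDefectFloor`.
-/

noncomputable section

open Literature.Analysis.FluidPDE MeasureTheory Set Function Filter Topology Metric WithLp
open scoped InnerProductSpace RealInnerProductSpace Laplacian ContDiff

namespace Summit.NavierStokesRegularity.NavierStokesRegularity.Theorems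

-- the problem directory repeats the summit name (`NavierStokesRegularity/NavierStokesRegularity`)
set_option linter.dupNamespace false

/-- **The engine with the defect floor asked only inside the inflow jet**: as
`radialMomentum_minPrinciple_engine_wall`, but the floor `defect ≥ −g(t)` is required only at off-axis
spatial critical points `x` of `Φ(t,·)` with `ΔΦ ≥ 0` AND `Φ(t,x) < −L` (inflow already stronger than the
wall / initial level). Proof: the weak maximum principle needs the sub-solution property only on the
positivity set of `w = −Φ − ∫₀ᵗ g − L` (`weak_max_principle_of_contDiffAt_of_pos`). [new] -/
theorem radialMomentum_minPrinciple_engine_jet {ν T : ℝ} {u : ℝ → EuclideanSpace ℝ (Fin 3) → EuclideanSpace ℝ (Fin 3)} {p : ℝ → EuclideanSpace ℝ (Fin 3) → ℝ}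
    (H : AxisymmetricL3Hyp ν T u p) {δ₁ R L I : ℝ}
    {g : ℝ → ℝ} (hgc : ContinuousOn g (Ico 0 T)) (hg0 : ∀ t ∈ Ico 0 T, 0 ≤ g t)
    (hgI : ∀ t ∈ Ico 0 T, ∫ s in (0:ℝ)..t, g s ≤ I)
    (hfloor : ∀ t ∈ Ico 0 T, ∀ x ∈ ball (0 : EuclideanSpace ℝ (Fin 3)) R ∩ {x | cylRadius x < δ₁},
      cylRadius x ≠ 0 → x 0 * u t x 0 + x 1 * u t x 1 < -L →
      fderiv ℝ (fun z : EuclideanSpace ℝ (Fin 3) => z 0 * u t z 0 + z 1 * u t z 1) x = 0 →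
      0 ≤ (Δ (fun z : EuclideanSpace ℝ (Fin 3) => z 0 * u t z 0 + z 1 * u t z 1)) x →
      -g t ≤ (u t x 0) ^ 2 + (u t x 1) ^ 2
        - (x 0 * fderiv ℝ (p t) x (EuclideanSpace.single 0 1)
            + x 1 * fderiv ℝ (p t) x (EuclideanSpace.single 1 1)))
    (hlat : ∀ t ∈ Ico 0 T, ∀ x ∈ (closedBall (0 : EuclideanSpace ℝ (Fin 3)) R ∩ {x | cylRadius x ≤ δ₁}) \
      (ball (0 : EuclideanSpace ℝ (Fin 3)) R ∩ {x | cylRadius x < δ₁}), -L ≤ x 0 * u t x 0 + x 1 * u t x 1)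
    (hbot : ∀ x ∈ closedBall (0 : EuclideanSpace ℝ (Fin 3)) R ∩ {x | cylRadius x ≤ δ₁},
      -L ≤ x 0 * u 0 x 0 + x 1 * u 0 x 1) :
    ∀ t ∈ Ico 0 T, ∀ x ∈ closedBall (0 : EuclideanSpace ℝ (Fin 3)) R ∩ {x | cylRadius x ≤ δ₁},
      -(L + I) ≤ x 0 * u t x 0 + x 1 * u t x 1 := by
  intro t ht x hx
  set K : Set (EuclideanSpace ℝ (Fin 3)) := closedBall (0 : EuclideanSpace ℝ (Fin 3)) R ∩ {x | cylRadius x ≤ δ₁} with hK_def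
  set U : Set (EuclideanSpace ℝ (Fin 3)) := ball (0 : EuclideanSpace ℝ (Fin 3)) R ∩ {x | cylRadius x < δ₁} with hU_def
  set G : ℝ → ℝ := fun s => ∫ τ in (0:ℝ)..s, g τ with hG_def
  set w : ℝ → EuclideanSpace ℝ (Fin 3) → ℝ := fun s y => -(y 0 * u s y 0 + y 1 * u s y 1) - G s - L with hw_def
  set wt : ℝ → EuclideanSpace ℝ (Fin 3) → ℝ := fun s y =>
    -(y 0 * timeDerivWithin (Ico 0 T) u s y 0 + y 1 * timeDerivWithin (Ico 0 T) u s y 1) - g s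
    with hwt_def
  have hν := H.viscosity_pos
  have hsm := H.classical.smooth_velocity
  have htT : Icc 0 t ⊆ Ico 0 T := fun s hs => ⟨hs.1, hs.2.trans_lt ht.2⟩
  -- the time integral of the floor
  have hG0 : G 0 = 0 := intervalIntegral.integral_same
  have hGnn : ∀ s ∈ Icc 0 t, 0 ≤ G s := fun s hs =>
    intervalIntegral.integral_nonneg hs.1 fun τ hτ => hg0 τ ⟨hτ.1, hτ.2.trans_lt (hs.2.trans_lt ht.2)⟩
  -- the sets
  have hK : IsCompact K :=
    (isCompact_closedBall _ _).inter_right (isClosed_le continuous_cylRadius continuous_const)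
  have hU : IsOpen U := isOpen_ball.inter (isOpen_lt continuous_cylRadius continuous_const)
  have hUK : U ⊆ K := fun y hy =>
    ⟨ball_subset_closedBall hy.1, (le_of_lt (hy.2 : cylRadius y < δ₁) : cylRadius y ≤ δ₁)⟩
  -- joint continuity of `w` on `[0,t] × K`
  have hc : ContinuousOn (uncurry w) (Icc 0 t ×ˢ K) := by
    have hu : ContinuousOn (uncurry u) (Icc 0 t ×ˢ K) :=
      hsm.continuousOn.mono (prod_mono htT (subset_univ _))
    have h0 : ContinuousOn (fun q : ℝ × EuclideanSpace ℝ (Fin 3) => uncurry u q 0) (Icc 0 t ×ˢ K) :=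
      (EuclideanSpace.proj (0 : Fin 3)).continuous.comp_continuousOn hu
    have h1 : ContinuousOn (fun q : ℝ × EuclideanSpace ℝ (Fin 3) => uncurry u q 1) (Icc 0 t ×ˢ K) :=
      (EuclideanSpace.proj (1 : Fin 3)).continuous.comp_continuousOn hu
    have hy0 : Continuous (fun q : ℝ × EuclideanSpace ℝ (Fin 3) => q.2 0) := (EuclideanSpace.proj (0 : Fin 3)).continuous.comp continuous_snd
    have hy1 : Continuous (fun q : ℝ × EuclideanSpace ℝ (Fin 3) => q.2 1) := (EuclideanSpace.proj (1 : Fin 3)).continuous.comp continuous_snd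
    have hGc : ContinuousOn G (Icc 0 t) := by
      have hint : IntegrableOn g (uIcc 0 t) := by
        rw [uIcc_of_le ht.1]
        exact (hgc.mono htT).integrableOn_compact isCompact_Icc
      have := intervalIntegral.continuousOn_primitive_interval (μ := volume) hint
      rwa [uIcc_of_le ht.1] at this
    have hGc' : ContinuousOn (fun q : ℝ × EuclideanSpace ℝ (Fin 3) => G q.1) (Icc 0 t ×ˢ K) :=
      hGc.comp continuous_fst.continuousOn fun q hq => hq.1
    have e : uncurry w = fun q : ℝ × EuclideanSpace ℝ (Fin 3) =>
        -(q.2 0 * uncurry u q 0 + q.2 1 * uncurry u q 1) - G q.1 - L := by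
      funext q
      rfl
    rw [e]
    exact ((((hy0.continuousOn.mul h0).add (hy1.continuousOn.mul h1)).neg.sub hGc').sub
      continuousOn_const)
  -- slice regularity
  have h2 : ∀ s ∈ Ioc 0 t, ∀ y ∈ U, ContDiffAt ℝ 2 (w s) y := by
    intro s hs y _
    have hs' : s ∈ Ico 0 T := ⟨hs.1.le, hs.2.trans_lt ht.2⟩
    have hU2 : ContDiff ℝ 2 (u s) := (H.classical.contDiff_velocity hs').of_le (by norm_cast)
    exact (((contDiff_radialMomentum hU2).neg.sub contDiff_const).sub contDiff_const).contDiffAt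
  -- the left time derivative
  have hderiv : ∀ s ∈ Ioc 0 t, ∀ y ∈ U,
      HasDerivWithinAt (fun τ => w τ y) (wt s y) (Icc 0 s) s := by
    intro s hs y _
    have hs' : s ∈ Ico 0 T := ⟨hs.1.le, hs.2.trans_lt ht.2⟩
    have hsT : s ∈ Ioo 0 T := ⟨hs.1, hs.2.trans_lt ht.2⟩
    have hΦ := (hasDerivWithinAt_radialMomentum hsm hs' y).mono
      (show Icc 0 s ⊆ Ico 0 T from fun τ hτ => ⟨hτ.1, hτ.2.trans_lt hsT.2⟩)
    have hgs : ContinuousAt g s :=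
      (hgc.mono Ioo_subset_Ico_self).continuousAt (isOpen_Ioo.mem_nhds hsT)
    have hmeas : StronglyMeasurableAtFilter g (𝓝 s) volume :=
      (hgc.mono Ioo_subset_Ico_self).stronglyMeasurableAtFilter isOpen_Ioo _ hsT
    have hii : IntervalIntegrable g volume 0 s := by
      refine (hgc.mono ?_).intervalIntegrable
      rw [uIcc_of_le hs.1.le]
      exact fun τ hτ => ⟨hτ.1, hτ.2.trans_lt hsT.2⟩
    have hG : HasDerivAt G (g s) s := intervalIntegral.integral_hasDerivAt_right hii hmeas hgs
    exact (hΦ.neg.sub hG.hasDerivWithinAt).sub_const L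
  -- the sub-solution property at interior critical points
  have hsub : ∀ s ∈ Ioc 0 t, ∀ y ∈ U, 0 < w s y → fderiv ℝ (w s) y = 0 → (Δ (w s)) y ≤ 0 →
      wt s y ≤ 0 := by
    intro s hs y hy hwpos hgrad hlap
    have hs' : s ∈ Ico 0 T := ⟨hs.1.le, hs.2.trans_lt ht.2⟩
    have hU2 : ContDiff ℝ 2 (u s) := (H.classical.contDiff_velocity hs').of_le (by norm_cast)
    have hΦ2 : ContDiff ℝ 2 (fun z : EuclideanSpace ℝ (Fin 3) => z 0 * u s z 0 + z 1 * u s z 1) :=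
      contDiff_radialMomentum hU2
    have hw_eq : w s = fun z => -(z 0 * u s z 0 + z 1 * u s z 1) - (G s + L) := by
      funext z
      simp only [hw_def]
      ring
    have hgradΦ : fderiv ℝ (fun z : EuclideanSpace ℝ (Fin 3) => z 0 * u s z 0 + z 1 * u s z 1) y = 0 := by
      have e : fderiv ℝ (w s) y = -fderiv ℝ (fun z : EuclideanSpace ℝ (Fin 3) => z 0 * u s z 0 + z 1 * u s z 1) y := by
        rw [hw_eq, fderiv_sub_const, fderiv_fun_neg]
      rw [e] at hgrad
      exact neg_eq_zero.1 hgrad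
    have hlapΦ : 0 ≤ (Δ (fun z : EuclideanSpace ℝ (Fin 3) => z 0 * u s z 0 + z 1 * u s z 1)) y := by
      have e : (Δ (w s)) y = -(Δ (fun z : EuclideanSpace ℝ (Fin 3) => z 0 * u s z 0 + z 1 * u s z 1)) y := by
        rw [hw_eq]
        exact laplacian_neg_sub_const hΦ2 _ y
      rw [e] at hlap
      linarith
    have hg0s := hg0 s hs'
    by_cases hax : cylRadius y = 0
    · obtain ⟨h0, h1⟩ := (cylRadius_eq_zero_iff y).1 hax
      simp only [hwt_def, h0, h1, zero_mul, add_zero, neg_zero, zero_sub]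
      linarith
    · have hUD : UniqueDiffWithinAt ℝ (Ico 0 T) s := uniqueDiffOn_Ico 0 T s hs'
      have hcrit := timeDerivWithin_radialMomentum_of_critical H.classical hs' hUD
        (H.axisymmetric s hs') hax hgradΦ
      have e := timeDerivWithin_radialMomentum hsm hs' hUD y
      have hΦlt : y 0 * u s y 0 + y 1 * u s y 1 < -L := by
        have hG := hGnn s ⟨hs.1.le, hs.2⟩
        simp only [hw_def] at hwpos
        linarith
      have hfl := hfloor s hs' y hy hax hΦlt hgradΦ hlapΦ
      have hνΔ : 0 ≤ ν * (Δ (fun z : EuclideanSpace ℝ (Fin 3) => z 0 * u s z 0 + z 1 * u s z 1)) y :=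
        mul_nonneg hν.le hlapΦ
      simp only [hwt_def]
      rw [← e, hcrit]
      simp only [Pi.zero_apply, PiLp.zero_apply, mul_zero, add_zero]
      linarith
  -- the parabolic boundary
  have hbot' : ∀ y ∈ K, w 0 y ≤ 0 := by
    intro y hy
    have h := hbot y hy
    simp only [hw_def, hG0]
    linarith
  have hlat' : ∀ s ∈ Icc 0 t, ∀ y ∈ K \ U, w s y ≤ 0 := by
    intro s hs y hy
    have h := hlat s (htT hs) y hy
    have hG := hGnn s hs
    simp only [hw_def]
    linarith
  -- the weak maximum principle
  have key := weak_max_principle_of_contDiffAt_of_pos hK hU hUK hc h2 hderiv hsub hbot' hlat' t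
    ⟨ht.1, le_rfl⟩ x hx
  have hGI : G t ≤ I := hgI t ht
  simp only [hw_def] at key
  linarith


/-- **One-wall inflow + jet pressure-excess criterion.** As
`hasSmoothExtensionPast_of_wallInflow_of_criticalDefectFloor` (`…WallFloorCriterion.lean`), with the floor
for the cyclostrophic defect `u_r² + u_θ² − r∂ᵣp ≥ −g(t)` asked only at the strongest-inflow points lying
INSIDE THE JET `{r u_r < −L}` (inflow exceeding the wall / far / initial level `L`). Contrapositive: an
axisymmetric blow-up at `T` with `r u_r ≥ −L` on a wall `{r = δ₁}`, far away and initially, carries a jet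
`{r u_r < −L}` inside the tube whose strongest-inflow points accumulate a pressure-pull excess
`∫ (r∂ᵣp − u_r² − u_θ²)⁺ dt ≥ 2ν − L`. [new] -/
theorem hasSmoothExtensionPast_of_wallInflow_of_jetDefectFloor {ν T : ℝ}
    {u : ℝ → EuclideanSpace ℝ (Fin 3) → EuclideanSpace ℝ (Fin 3)} {p : ℝ → EuclideanSpace ℝ (Fin 3) → ℝ}
    (H : AxisymmetricL3Hyp ν T u p) (hdec : HasRapidSpatialDecay (u 0)) {δ₁ R L I : ℝ} (hδ₁ : 0 < δ₁)
    {g : ℝ → ℝ} (hgc : ContinuousOn g (Ico 0 T)) (hg0 : ∀ t ∈ Ico 0 T, 0 ≤ g t)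
    (hgI : ∀ t ∈ Ico 0 T, ∫ s in (0:ℝ)..t, g s ≤ I)
    (hwall : ∀ t ∈ Ico 0 T, ∀ x, cylRadius x ≤ δ₁ → (δ₁ ≤ cylRadius x ∨ R ≤ ‖x‖) →
      -L ≤ x 0 * u t x 0 + x 1 * u t x 1)
    (hbot : ∀ x, cylRadius x ≤ δ₁ → -L ≤ x 0 * u 0 x 0 + x 1 * u 0 x 1)
    (hfloor : ∀ t ∈ Ico 0 T, ∀ x ∈ ball (0 : EuclideanSpace ℝ (Fin 3)) R ∩ {x | cylRadius x < δ₁},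
      cylRadius x ≠ 0 → x 0 * u t x 0 + x 1 * u t x 1 < -L →
      fderiv ℝ (fun z : EuclideanSpace ℝ (Fin 3) => z 0 * u t z 0 + z 1 * u t z 1) x = 0 →
      0 ≤ (Δ (fun z : EuclideanSpace ℝ (Fin 3) => z 0 * u t z 0 + z 1 * u t z 1)) x →
      -g t ≤ (u t x 0) ^ 2 + (u t x 1) ^ 2
        - (x 0 * fderiv ℝ (p t) x (EuclideanSpace.single 0 1)
            + x 1 * fderiv ℝ (p t) x (EuclideanSpace.single 1 1)))
    (hbudget : L + I < 2 * ν) :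
    HasSmoothExtensionPast ν 0 u T := by
  have hν := H.viscosity_pos
  have hT := H.time_pos
  have hI0 : 0 ≤ I := by
    have h := hgI 0 ⟨le_rfl, hT⟩
    rwa [intervalIntegral.integral_same] at h
  -- the engine on the truncated tube
  have key := radialMomentum_minPrinciple_engine_jet H hgc hg0 hgI hfloor
    (fun t ht x hx => by
      have hxK := hx.1
      have hr : cylRadius x ≤ δ₁ := hxK.2
      refine hwall t ht x hr ?_
      by_cases hxR : R ≤ ‖x‖
      · exact Or.inr hxR
      · have hxb : x ∈ ball (0 : EuclideanSpace ℝ (Fin 3)) R := mem_ball_zero_iff.2 (lt_of_not_ge hxR)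
        left
        by_contra hlt
        exact hx.2 ⟨hxb, lt_of_not_ge hlt⟩)
    (fun x hx => hbot x hx.2)
  -- the one-sided radial criterion with the subcritical constant `(L + I)/ν < 2`
  have hC : (L + I) / ν < 2 := by
    rw [div_lt_iff₀ hν]
    linarith
  refine ScenarioCensus.LogGate.oneSidedRadialCriterion_of_lt_two (C := (L + I) / ν) hν hT hC hδ₁
    H.classical H.lerayHopf H.bounded_subslab H.axisymmetric hdec fun t ht x hx => ?_
  have hCν : (L + I) / ν * ν = L + I := div_mul_cancel₀ _ hν.ne'
  rw [hCν]
  by_cases hxR : ‖x‖ ≤ R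
  · exact key t ht x ⟨mem_closedBall_zero_iff.2 hxR, (le_of_lt hx : cylRadius x ≤ δ₁)⟩
  · have h := hwall t ht x (le_of_lt hx) (Or.inr (le_of_not_ge hxR))
    linarith

open Summit.NavierStokesRegularity.NavierStokesRegularity.Theses.TypeIIInviscidRelaxation in
/-- **A one-statement sufficient condition for the crux (alternative line shape), BY NAME.** If EVERY
solution of the standing class admits a tube radius `δ₁ > 0`, a ball radius `R`, a wall level `L`, a
budget `I` and a continuous floor `g ≥ 0` on `[0,T)` with `∫₀ᵗ g ≤ I` such that: the radial momentum
`x₀u₀ + x₁u₁ = r u_r` is `≥ −L` on the wall `{r = δ₁}` and the far region `{|x| ≥ R}` of the tube for all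
times and on the tube initially; the cyclostrophic defect is `≥ −g(t)` at the strongest-inflow points of
the jet `{r u_r < −L}`; and `L + I < 2ν` — then `AxisymSwirlRegular` ⟨1964⟩ holds, through
`axisymSwirlRegular_of_noBlowup` and `hasSmoothExtensionPast_of_wallInflow_of_jetDefectFloor`, i.e.
WITHOUT the open half `C ≥ 2` of ⟨19059⟩. The hypothesis (an a-priori «wall/jet budget») is open;
nothing is closed. [new] -/
theorem axisymSwirlRegular_of_aprioriWallJetBudget
    (hB : ∀ (ν T : ℝ), 0 < ν → 0 < T →
      ∀ (u : ℝ → EuclideanSpace ℝ (Fin 3) → EuclideanSpace ℝ (Fin 3))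
        (p : ℝ → EuclideanSpace ℝ (Fin 3) → ℝ),
        IsClassicalNSSolutionOn (Set.Ico 0 T) ν 0 u p → IsLerayHopfOn T ν 0 (u 0) u →
        (∀ T' < T, ∃ M : ℝ, ∀ t ∈ Set.Icc 0 T', ∀ x, ‖u t x‖ ≤ M) →
        (∀ t ∈ Set.Ico 0 T, IsAxisymmetric (u t)) → HasRapidSpatialDecay (u 0) →
        ∃ (δ₁ R L I : ℝ) (g : ℝ → ℝ), 0 < δ₁ ∧ ContinuousOn g (Ico 0 T) ∧ (∀ t ∈ Ico 0 T, 0 ≤ g t) ∧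
          (∀ t ∈ Ico 0 T, ∫ s in (0:ℝ)..t, g s ≤ I) ∧
          (∀ t ∈ Ico 0 T, ∀ x, cylRadius x ≤ δ₁ → (δ₁ ≤ cylRadius x ∨ R ≤ ‖x‖) →
            -L ≤ x 0 * u t x 0 + x 1 * u t x 1) ∧
          (∀ x, cylRadius x ≤ δ₁ → -L ≤ x 0 * u 0 x 0 + x 1 * u 0 x 1) ∧
          (∀ t ∈ Ico 0 T, ∀ x ∈ ball (0 : EuclideanSpace ℝ (Fin 3)) R ∩ {x | cylRadius x < δ₁},
            cylRadius x ≠ 0 → x 0 * u t x 0 + x 1 * u t x 1 < -L →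
            fderiv ℝ (fun z : EuclideanSpace ℝ (Fin 3) => z 0 * u t z 0 + z 1 * u t z 1) x = 0 →
            0 ≤ (Δ (fun z : EuclideanSpace ℝ (Fin 3) => z 0 * u t z 0 + z 1 * u t z 1)) x →
            -g t ≤ (u t x 0) ^ 2 + (u t x 1) ^ 2
              - (x 0 * fderiv ℝ (p t) x (EuclideanSpace.single 0 1)
                  + x 1 * fderiv ℝ (p t) x (EuclideanSpace.single 1 1))) ∧
          L + I < 2 * ν) :
    AxisymSwirlRegular :=
  axisymSwirlRegular_of_noBlowup fun ν T hν hT u p hcl hLH hbd hax hdec => by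
    obtain ⟨δ₁, R, L, I, g, hδ₁, hgc, hg0, hgI, hwall, hbot, hfloor, hbudget⟩ :=
      hB ν T hν hT u p hcl hLH hbd hax hdec
    exact hasSmoothExtensionPast_of_wallInflow_of_jetDefectFloor ⟨hν, hT, hcl, hLH, hbd, hax⟩ hdec hδ₁
      hgc hg0 hgI hwall hbot hfloor hbudget

open Summit.NavierStokesRegularity.NavierStokesRegularity.Theses.TypeIIInviscidRelaxation in
/-- **The wall/jet budget is NECESSARY for the crux — trivially.** Under `AxisymSwirlRegular` every
solution of the standing class is bounded by some `B` on `[0,T) × ℝ³`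
(`hasSmoothExtensionPast_and_bounded_of_axisymSwirlRegular`); on the tube `{r ≤ δ₁}`,
`δ₁ = ν/(2(B⁺+1))`, one has `r u_r ≥ −δ₁B ≥ −ν/2 =: −L`, so the wall, far and initial conditions hold, the
jet `{r u_r < −L}` is EMPTY (the pressure floor is vacuous, `g = 0`, `I = 0`), and `L + I = ν/2 < 2ν`. [new] -/
theorem aprioriWallJetBudget_of_axisymSwirlRegular (hAX : AxisymSwirlRegular) :
    ∀ (ν T : ℝ), 0 < ν → 0 < T →
      ∀ (u : ℝ → EuclideanSpace ℝ (Fin 3) → EuclideanSpace ℝ (Fin 3))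
        (p : ℝ → EuclideanSpace ℝ (Fin 3) → ℝ),
        IsClassicalNSSolutionOn (Set.Ico 0 T) ν 0 u p → IsLerayHopfOn T ν 0 (u 0) u →
        (∀ T' < T, ∃ M : ℝ, ∀ t ∈ Set.Icc 0 T', ∀ x, ‖u t x‖ ≤ M) →
        (∀ t ∈ Set.Ico 0 T, IsAxisymmetric (u t)) → HasRapidSpatialDecay (u 0) →
        ∃ (δ₁ R L I : ℝ) (g : ℝ → ℝ), 0 < δ₁ ∧ ContinuousOn g (Ico 0 T) ∧ (∀ t ∈ Ico 0 T, 0 ≤ g t) ∧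
          (∀ t ∈ Ico 0 T, ∫ s in (0:ℝ)..t, g s ≤ I) ∧
          (∀ t ∈ Ico 0 T, ∀ x, cylRadius x ≤ δ₁ → (δ₁ ≤ cylRadius x ∨ R ≤ ‖x‖) →
            -L ≤ x 0 * u t x 0 + x 1 * u t x 1) ∧
          (∀ x, cylRadius x ≤ δ₁ → -L ≤ x 0 * u 0 x 0 + x 1 * u 0 x 1) ∧
          (∀ t ∈ Ico 0 T, ∀ x ∈ ball (0 : EuclideanSpace ℝ (Fin 3)) R ∩ {x | cylRadius x < δ₁},
            cylRadius x ≠ 0 → x 0 * u t x 0 + x 1 * u t x 1 < -L →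
            fderiv ℝ (fun z : EuclideanSpace ℝ (Fin 3) => z 0 * u t z 0 + z 1 * u t z 1) x = 0 →
            0 ≤ (Δ (fun z : EuclideanSpace ℝ (Fin 3) => z 0 * u t z 0 + z 1 * u t z 1)) x →
            -g t ≤ (u t x 0) ^ 2 + (u t x 1) ^ 2
              - (x 0 * fderiv ℝ (p t) x (EuclideanSpace.single 0 1)
                  + x 1 * fderiv ℝ (p t) x (EuclideanSpace.single 1 1))) ∧
          L + I < 2 * ν := by
  intro ν T hν hT u p hcl hLH hbd hax hdec
  obtain ⟨-, B, hB⟩ := hasSmoothExtensionPast_and_bounded_of_axisymSwirlRegular hAX hν hT hcl hLH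
    (hax 0 (left_mem_Ico.2 hT)) hdec
  set B' : ℝ := max B 0 with hB'_def
  have hB'0 : 0 ≤ B' := le_max_right _ _
  have hB'B : B ≤ B' := le_max_left _ _
  set δ₁ : ℝ := ν / (2 * (B' + 1)) with hδ₁_def
  have hδ₁ : 0 < δ₁ := div_pos hν (by positivity)
  -- on the tube, `r u_r ≥ −δ₁ B' ≥ −ν/2`
  have hδB : δ₁ * B' ≤ ν / 2 := by
    rw [hδ₁_def, div_mul_eq_mul_div, div_le_div_iff₀ (by positivity) (by norm_num)]
    nlinarith
  have htube : ∀ t ∈ Ico 0 T, ∀ x, cylRadius x ≤ δ₁ → -(ν / 2) ≤ x 0 * u t x 0 + x 1 * u t x 1 := by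
    intro t ht x hx
    have h := radialMomentum_ge_neg_mul_of_norm_le hx ((hB t ht x).trans hB'B)
    linarith
  refine ⟨δ₁, 0, ν / 2, 0, fun _ => 0, hδ₁, continuousOn_const, fun _ _ => le_rfl, fun t _ => ?_,
    fun t ht x hx _ => htube t ht x hx, fun x hx => htube 0 (left_mem_Ico.2 hT) x hx, ?_, by linarith⟩
  · simp
  · intro t ht x hx _ hlt _ _
    exact absurd (htube t ht x (le_of_lt (hx.2 : cylRadius x < δ₁))) (not_le.2 hlt)

open Summit.NavierStokesRegularity.NavierStokesRegularity.Theses.TypeIIInviscidRelaxation in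
/-- **Equivalence certificate for the alternative line shape**: `AxisymSwirlRegular` ⟨1964⟩ holds iff
every solution of the standing class satisfies the a-priori wall/jet budget (tube radius, wall inflow
level `L`, jet pressure-excess floor with `∫g ≤ I`, `L + I < 2ν`). `←` is
`axisymSwirlRegular_of_aprioriWallJetBudget` (min principle + the `C < 2` one-sided criterion); `→` is
boundedness (`aprioriWallJetBudget_of_axisymSwirlRegular`, jet empty). So the a-priori content of the crux
is exactly: keep the radial inflow above a fixed level on ONE thin cylinder wall, OR ELSE bound the
cumulative pressure-pull excess `∫(r∂ᵣp − u_r² − u_θ²)⁺` at the strongest-inflow points of the jet. [new] -/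
theorem axisymSwirlRegular_iff_aprioriWallJetBudget :
    AxisymSwirlRegular ↔
    ∀ (ν T : ℝ), 0 < ν → 0 < T →
      ∀ (u : ℝ → EuclideanSpace ℝ (Fin 3) → EuclideanSpace ℝ (Fin 3))
        (p : ℝ → EuclideanSpace ℝ (Fin 3) → ℝ),
        IsClassicalNSSolutionOn (Set.Ico 0 T) ν 0 u p → IsLerayHopfOn T ν 0 (u 0) u →
        (∀ T' < T, ∃ M : ℝ, ∀ t ∈ Set.Icc 0 T', ∀ x, ‖u t x‖ ≤ M) →
        (∀ t ∈ Set.Ico 0 T, IsAxisymmetric (u t)) → HasRapidSpatialDecay (u 0) →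
        ∃ (δ₁ R L I : ℝ) (g : ℝ → ℝ), 0 < δ₁ ∧ ContinuousOn g (Ico 0 T) ∧ (∀ t ∈ Ico 0 T, 0 ≤ g t) ∧
          (∀ t ∈ Ico 0 T, ∫ s in (0:ℝ)..t, g s ≤ I) ∧
          (∀ t ∈ Ico 0 T, ∀ x, cylRadius x ≤ δ₁ → (δ₁ ≤ cylRadius x ∨ R ≤ ‖x‖) →
            -L ≤ x 0 * u t x 0 + x 1 * u t x 1) ∧
          (∀ x, cylRadius x ≤ δ₁ → -L ≤ x 0 * u 0 x 0 + x 1 * u 0 x 1) ∧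
          (∀ t ∈ Ico 0 T, ∀ x ∈ ball (0 : EuclideanSpace ℝ (Fin 3)) R ∩ {x | cylRadius x < δ₁},
            cylRadius x ≠ 0 → x 0 * u t x 0 + x 1 * u t x 1 < -L →
            fderiv ℝ (fun z : EuclideanSpace ℝ (Fin 3) => z 0 * u t z 0 + z 1 * u t z 1) x = 0 →
            0 ≤ (Δ (fun z : EuclideanSpace ℝ (Fin 3) => z 0 * u t z 0 + z 1 * u t z 1)) x →
            -g t ≤ (u t x 0) ^ 2 + (u t x 1) ^ 2
              - (x 0 * fderiv ℝ (p t) x (EuclideanSpace.single 0 1)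
                  + x 1 * fderiv ℝ (p t) x (EuclideanSpace.single 1 1))) ∧
          L + I < 2 * ν :=
  ⟨aprioriWallJetBudget_of_axisymSwirlRegular, axisymSwirlRegular_of_aprioriWallJetBudget⟩

end Summit.NavierStokesRegularity.NavierStokesRegularity.Theorems

end
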